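import Summits.BirchSwinnertonDyer.BirchSwinnertonDyer.Theorems.ClassRecordThreeEulerHalvesAtThreeCartanSupplyPermSubmodule
import Summits.BirchSwinnertonDyer.BirchSwinnertonDyer.Theorems.ClassRecordThreeEulerHalvesAtThreeCartanTorusCubeCutPSChar
import HarnessLib

/-!
# SUPPLY from PERMUTATION MODELS, III — the ISOTYPIC KERNEL: the sublattice, its stability, purity, coordinate sums and basis come for free

Helper file riding `--supports stmt-BirchSwinnertonDyer-19109` (crux `EulerHalvesAtThree`; UNREGISTERED sub-line `Cruxes/EulerHalvesAtThree/Lines/cartan_corr`,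
seat `bsd-idea-10` g12), continuing `…CartanSupplyPermModel` (p692372) and `…CartanSupplyPermSubmodule` (the transport). On the permutation lattice `ℤ^n` of
`σ : G →* Perm (Fin n)` (`G = GL₂(𝔽_q)`) the CLASS-SUM OPERATOR `M_χ = Σ_g χ(g)·permAct σ g` of a class function `χ` commutes with the action
(`classSumOp_equivariant`), so the ISOTYPIC OPERATOR `A = χ(1)·M_χ − #G·id` (`isotypicOp`; over `ℚ`, `A = 0` cuts out the `χ`-isotypic component when `χ` is an
irreducible character of degree `χ(1)`) has a `G`-STABLE kernel (`ker_isotypicOp_stable`, with `χ = χ_{W_q}` a class function by `CartanTorusCubeCut.PS.char_conj`),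
which is PURE (`ker_pure`: kernels in `ℤ^n` are saturated) and has coordinate sums `0` as soon as `Σ_g χ(g) = 0` (`sum_eq_zero_of_mem_ker`); a `ℤ`-basis exists
(`Submodule.basisOfPid`). Hence `ofIsotypicKernel : CartanIsotypicKernelDatum q → CartanPermSubmodule q` and
`cartanTorusLatticeSupply_of_isotypicKernelSupply : CartanIsotypicKernelSupply → CartanTorusLatticeSupply` (SUPPLY, the v11 stub of 23422's line `cartan`,
BY NAME), where a `CartanIsotypicKernelDatum q` retains ONLY: the transitive `G`-set `Fin n` with `3 ∤ n` (intended: `G∕T`, `T` the torus of index prime to 3),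
the vanishing `Σ_g χ_W(g) = 0` (`⟨χ_W, 𝟙⟩ = 0`), the TRACE IDENTITY `tr((permAct σ g)|_{ker A}) = χ_W(g)` («`W_q` occurs once in `ℚ[G∕T]`»), `η`, and the two
torus-fixed lines in `ker A`. HONEST FRAMING: constructions and elementary lemmas; SUPPLY ∕ NUM ∕ (F2b♭) ∕ the cruxes are NOT proved; BSD is proved for no
curve. [folklore]
-/

set_option linter.dupNamespace false
set_option autoImplicit false

namespace Summit.BirchSwinnertonDyer.BirchSwinnertonDyer.Theorems.CartanSupply

open Summit.BirchSwinnertonDyer.BirchSwinnertonDyer.Theorems.CartanDegree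
open Summit.BirchSwinnertonDyer.BirchSwinnertonDyer.Theorems.CartanCorrespondence

/-! ## §1 Kernels of equivariant operators on `ℤ^n` are stable and pure -/

section general
variable {G : Type*} [Group G] {n : ℕ} (σ : G →* Equiv.Perm (Fin n))

/-- PROVED: the kernel of an equivariant operator is stable. [folklore] -/
theorem ker_stable (A : (Fin n → ℤ) →ₗ[ℤ] (Fin n → ℤ)) (hA : ∀ g φ, A (permAct σ g φ) = permAct σ g (A φ)) (g : G) :
    ∀ φ ∈ LinearMap.ker A, permAct σ g φ ∈ LinearMap.ker A := by
  intro φ hφ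
  rw [LinearMap.mem_ker] at hφ ⊢
  rw [hA, hφ, map_zero]

/-- PROVED: kernels in `ℤ^n` are pure. [folklore] -/
theorem ker_pure (A : (Fin n → ℤ) →ₗ[ℤ] (Fin n → ℤ)) :
    ∀ φ : Fin n → ℤ, (3 : ℤ) • φ ∈ LinearMap.ker A → φ ∈ LinearMap.ker A := by
  intro φ hφ
  rw [LinearMap.mem_ker] at hφ ⊢
  rw [map_smul] at hφ
  rcases smul_eq_zero.mp hφ with h | h
  · norm_num at h
  · exact h

/-- PROVED: the action preserves coordinate sums. [folklore] -/
theorem sum_permAct (g : G) (φ : Fin n → ℤ) : ∑ i, permAct σ g φ i = ∑ i, φ i :=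
  Equiv.sum_comp ((σ g)⁻¹) φ

variable [Fintype G]

/-- The class-sum operator `M_χ = Σ_g χ(g)·permAct σ g`. -/
noncomputable def classSumOp (χ : G → ℤ) : (Fin n → ℤ) →ₗ[ℤ] (Fin n → ℤ) :=
  ∑ g, χ g • ((permAct σ g : (Fin n → ℤ) →ₗ[ℤ] (Fin n → ℤ)))

/-- PROVED: unfolding. [folklore] -/
theorem classSumOp_apply (χ : G → ℤ) (φ : Fin n → ℤ) : classSumOp σ χ φ = ∑ g, χ g • permAct σ g φ := by
  rw [classSumOp, LinearMap.sum_apply]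
  exact Finset.sum_congr rfl (fun g _ => by rw [LinearMap.smul_apply])

/-- PROVED: `M_χ` commutes with the action when `χ` is a class function (reindex `g ↦ h g h⁻¹`). [folklore] -/
theorem classSumOp_equivariant (χ : G → ℤ) (hχ : ∀ h g, χ (h * g * h⁻¹) = χ g) (h : G) (φ : Fin n → ℤ) :
    classSumOp σ χ (permAct σ h φ) = permAct σ h (classSumOp σ χ φ) := by
  rw [classSumOp_apply, classSumOp_apply, map_sum]
  have hR : ∀ g, permAct σ h (χ g • permAct σ g φ) = χ g • permAct σ (h * g) φ := by
    intro g
    rw [map_smul, map_mul, Module.End.mul_apply]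
  have hL : ∀ g, χ g • permAct σ g (permAct σ h φ) = χ g • permAct σ (g * h) φ := by
    intro g
    rw [map_mul, Module.End.mul_apply]
  simp only [hR, hL]
  rw [← Fintype.sum_equiv (MulAut.conj h).toEquiv (fun g => χ (h * g * h⁻¹) • permAct σ (h * g * h⁻¹ * h) φ)
    (fun g => χ g • permAct σ (g * h) φ) (fun g => by simp only [MulEquiv.toEquiv_eq_coe, MulEquiv.coe_toEquiv, MulAut.conj_apply])]
  exact Finset.sum_congr rfl (fun g _ => by rw [hχ, inv_mul_cancel_right])

/-- PROVED: coordinate sums under `M_χ`: `Σ_i (M_χ φ)_i = (Σ_g χ g)·Σ_i φ_i`. [folklore] -/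
theorem sum_classSumOp (χ : G → ℤ) (φ : Fin n → ℤ) : ∑ i, classSumOp σ χ φ i = (∑ g, χ g) * ∑ i, φ i := by
  rw [classSumOp_apply]
  have h1 : ∀ i, (∑ g, χ g • permAct σ g φ) i = ∑ g, χ g * permAct σ g φ i := by
    intro i
    rw [Finset.sum_apply]
    exact Finset.sum_congr rfl (fun g _ => by rw [Pi.smul_apply, smul_eq_mul])
  simp only [h1]
  rw [Finset.sum_comm, Finset.sum_mul]
  exact Finset.sum_congr rfl (fun g _ => by rw [← Finset.mul_sum, sum_permAct])

/-- The isotypic operator `A = χ(1)·M_χ − #G·id`. -/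
noncomputable def isotypicOp (χ : G → ℤ) : (Fin n → ℤ) →ₗ[ℤ] (Fin n → ℤ) :=
  χ 1 • classSumOp σ χ - (Fintype.card G : ℤ) • LinearMap.id

/-- PROVED: unfolding. [folklore] -/
theorem isotypicOp_apply (χ : G → ℤ) (φ : Fin n → ℤ) :
    isotypicOp σ χ φ = χ 1 • classSumOp σ χ φ - (Fintype.card G : ℤ) • φ := by
  rw [isotypicOp, LinearMap.sub_apply, LinearMap.smul_apply, LinearMap.smul_apply, LinearMap.id_apply]

/-- PROVED: `A` commutes with the action for a class function. [folklore] -/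
theorem isotypicOp_equivariant (χ : G → ℤ) (hχ : ∀ h g, χ (h * g * h⁻¹) = χ g) (h : G) (φ : Fin n → ℤ) :
    isotypicOp σ χ (permAct σ h φ) = permAct σ h (isotypicOp σ χ φ) := by
  rw [isotypicOp_apply, isotypicOp_apply, classSumOp_equivariant σ χ hχ, map_sub, map_smul, map_smul]

/-- PROVED: coordinate sums vanish on `ker A` when `Σ_g χ(g) = 0`. [folklore] -/
theorem sum_eq_zero_of_mem_ker (χ : G → ℤ) (hχ0 : ∑ g, χ g = 0) [Nonempty G] :
    ∀ φ ∈ LinearMap.ker (isotypicOp σ χ), ∑ i, φ i = 0 := by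
  intro φ hφ
  rw [LinearMap.mem_ker, isotypicOp_apply, sub_eq_zero] at hφ
  have h1 : ∑ i, (χ 1 • classSumOp σ χ φ) i = ∑ i, ((Fintype.card G : ℤ) • φ) i := by rw [hφ]
  simp only [Pi.smul_apply, smul_eq_mul, ← Finset.mul_sum] at h1
  rw [sum_classSumOp, hχ0, zero_mul, mul_zero] at h1
  rcases mul_eq_zero.mp h1.symm with h | h
  · exact absurd h (by exact_mod_cast Fintype.card_ne_zero)
  · exact h

end general

/-! ## §2 The isotypic kernel of `χ_{W_q}` and the datum -/

variable {q : ℕ} [Fact q.Prime]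

/-- PROVED: `ker A_{χ_W}` is stable (`χ_W` is a class function, `CartanTorusCubeCut.PS.char_conj`). [folklore] -/
theorem ker_isotypicOp_stable {n : ℕ} (σ : GL (Fin 2) (ZMod q) →* Equiv.Perm (Fin n)) (g : GL (Fin 2) (ZMod q)) :
    ∀ φ ∈ LinearMap.ker (isotypicOp σ (cubicNewvectorChar q)), permAct σ g φ ∈ LinearMap.ker (isotypicOp σ (cubicNewvectorChar q)) :=
  ker_stable σ _ (fun h φ => isotypicOp_equivariant σ _ (fun a b => CartanTorusCubeCut.PS.char_conj a b) h φ) g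

/-- An ISOTYPIC-KERNEL DATUM at `q`: the transitive `G`-set with `3 ∤ n`, `Σ_g χ_W(g) = 0`, the trace identity on `ker A_{χ_W}`, `η`, and the two
torus-fixed lines in `ker A_{χ_W}`. -/
structure CartanIsotypicKernelDatum (q : ℕ) [Fact q.Prime] where
  /-- size of the `G`-set. -/
  n : ℕ
  /-- the permutation action of `GL₂(𝔽_q)` on `Fin n`. -/
  σ : GL (Fin 2) (ZMod q) →* Equiv.Perm (Fin n)
  σ_trans : ∀ i j : Fin n, ∃ g, σ g i = j
  three_not_dvd : ¬ 3 ∣ n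
  /-- `⟨χ_W, 𝟙⟩ = 0`. -/
  sum_char : ∑ g : GL (Fin 2) (ZMod q), cubicNewvectorChar q g = 0
  /-- traces of the action on the isotypic kernel `= χ_{W_q}`. -/
  trace_eq : ∀ g, LinearMap.trace ℤ (LinearMap.ker (isotypicOp σ (cubicNewvectorChar q)))
    ((permAct σ g).restrict (ker_isotypicOp_stable σ g)) = cubicNewvectorChar q g
  /-- the non-split torus `𝔽_q[η]^×`. -/
  η : Matrix (Fin 2) (Fin 2) (ZMod q)
  η_irred : ¬ HasRatEigenvalue η
  /-- generators of the split- ∕ non-split-torus-fixed lines of the kernel. -/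
  φS : Fin n → ℤ
  φC : Fin n → ℤ
  φS_mem : isotypicOp σ (cubicNewvectorChar q) φS = 0
  φC_mem : isotypicOp σ (cubicNewvectorChar q) φC = 0
  φS_fixed : ∀ g : GL (Fin 2) (ZMod q), (g : Matrix (Fin 2) (Fin 2) (ZMod q)) 0 1 = 0 →
    (g : Matrix (Fin 2) (Fin 2) (ZMod q)) 1 0 = 0 → permAct σ g φS = φS
  φC_fixed : ∀ g : GL (Fin 2) (ZMod q), (g : Matrix (Fin 2) (Fin 2) (ZMod q)) * η = η * g → permAct σ g φC = φC
  φS_gen : ∀ φ : Fin n → ℤ, isotypicOp σ (cubicNewvectorChar q) φ = 0 →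
    (∀ g : GL (Fin 2) (ZMod q), (g : Matrix (Fin 2) (Fin 2) (ZMod q)) 0 1 = 0 →
      (g : Matrix (Fin 2) (Fin 2) (ZMod q)) 1 0 = 0 → permAct σ g φ = φ) → ∃ m : ℤ, φ = m • φS
  φC_gen : ∀ φ : Fin n → ℤ, isotypicOp σ (cubicNewvectorChar q) φ = 0 →
    (∀ g : GL (Fin 2) (ZMod q), (g : Matrix (Fin 2) (Fin 2) (ZMod q)) * η = η * g → permAct σ g φ = φ) → ∃ m : ℤ, φ = m • φC
  φS_ne : φS ≠ 0
  φC_ne : φC ≠ 0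

/-- **ISOTYPIC-KERNEL SUPPLY**: every prime `q ≠ 3` carries an isotypic-kernel datum. [folklore] -/
@[conjecture]
def CartanIsotypicKernelSupply : Prop := ∀ q : ℕ, ∀ _hq : Fact q.Prime, q ≠ 3 → Nonempty (CartanIsotypicKernelDatum q)

/-! ## §3 The permutation submodule model of an isotypic-kernel datum; SUPPLY by name -/

/-- PROVED: field `L_stab` of the model below. [folklore] -/
theorem ofIsotypicKernel_stab (D : CartanIsotypicKernelDatum q) : ∀ g : GL (Fin 2) (ZMod q),
    ∀ φ ∈ LinearMap.ker (isotypicOp D.σ (cubicNewvectorChar q)), permAct D.σ g φ ∈ LinearMap.ker (isotypicOp D.σ (cubicNewvectorChar q)) :=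
  ker_isotypicOp_stable D.σ

/-- PROVED: field `L_pure` of the model below. [folklore] -/
theorem ofIsotypicKernel_pure (D : CartanIsotypicKernelDatum q) : ∀ φ : Fin D.n → ℤ,
    (3 : ℤ) • φ ∈ LinearMap.ker (isotypicOp D.σ (cubicNewvectorChar q)) → φ ∈ LinearMap.ker (isotypicOp D.σ (cubicNewvectorChar q)) :=
  ker_pure (isotypicOp D.σ (cubicNewvectorChar q))

/-- PROVED: field `L_sum` of the model below. [folklore] -/
theorem ofIsotypicKernel_sum (D : CartanIsotypicKernelDatum q) :
    ∀ φ ∈ LinearMap.ker (isotypicOp D.σ (cubicNewvectorChar q)), ∑ i, φ i = 0 :=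
  sum_eq_zero_of_mem_ker D.σ _ D.sum_char

/-- The permutation submodule model of an isotypic-kernel datum (`L = ker A_{χ_W}`, basis by `Submodule.basisOfPid`). -/
noncomputable def ofIsotypicKernel (D : CartanIsotypicKernelDatum q) : CartanPermSubmodule q where
  n := D.n
  σ := D.σ
  σ_trans := D.σ_trans
  three_not_dvd := D.three_not_dvd
  L := LinearMap.ker (isotypicOp D.σ (cubicNewvectorChar q))
  L_stab := ofIsotypicKernel_stab D
  L_pure := ofIsotypicKernel_pure D
  L_sum := ofIsotypicKernel_sum D
  d := (Submodule.basisOfPid (Pi.basisFun ℤ (Fin D.n)) (LinearMap.ker (isotypicOp D.σ (cubicNewvectorChar q)))).1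
  b := (Submodule.basisOfPid (Pi.basisFun ℤ (Fin D.n)) (LinearMap.ker (isotypicOp D.σ (cubicNewvectorChar q)))).2
  trace_eq := D.trace_eq
  η := D.η
  η_irred := D.η_irred
  φS := D.φS
  φC := D.φC
  φS_mem := LinearMap.mem_ker.mpr D.φS_mem
  φC_mem := LinearMap.mem_ker.mpr D.φC_mem
  φS_fixed := D.φS_fixed
  φC_fixed := D.φC_fixed
  φS_gen := fun φ hφ hfix => D.φS_gen φ (LinearMap.mem_ker.mp hφ) hfix
  φC_gen := fun φ hφ hfix => D.φC_gen φ (LinearMap.mem_ker.mp hφ) hfix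
  φS_ne := D.φS_ne
  φC_ne := D.φC_ne

/-- PROVED — one prime at a time: an isotypic-kernel datum at `q` gives the `q`-instance of SUPPLY. [folklore] -/
theorem cartanTorusLatticeSupplyAt_of_isotypicKernel (D : CartanIsotypicKernelDatum q) :
    ∃ (𝓛 : CartanTorusLattice q) (wS wC : Fin 𝓛.d → ℤ),
      𝓛.IsSplitFixed wS ∧ 𝓛.IsNonsplitFixed wC ∧
      (∀ v, 𝓛.IsSplitFixed v → ∃ m : ℤ, v = m • wS) ∧ (∀ v, 𝓛.IsNonsplitFixed v → ∃ m : ℤ, v = m • wC) ∧ wS ≠ 0 ∧ wC ≠ 0 :=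
  cartanTorusLatticeSupplyAt_of_permSubmodule (ofIsotypicKernel D)

omit [Fact q.Prime] in
/-- PROVED — **SUPPLY ⟸ ISOTYPIC-KERNEL SUPPLY** (`CartanTorusLatticeSupply` BY NAME). [folklore] -/
theorem cartanTorusLatticeSupply_of_isotypicKernelSupply (h : CartanIsotypicKernelSupply) : CartanTorusLatticeSupply :=
  fun q hq h3 => (h q ⟨hq⟩ h3).elim fun D => @cartanTorusLatticeSupplyAt_of_isotypicKernel q ⟨hq⟩ D

end Summit.BirchSwinnertonDyer.BirchSwinnertonDyer.Theorems.CartanSupply
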